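import Literature.MathematicalPhysics.QuantumLattice.HubbardTTPrimePointGroupCovariance
import Literature.MathematicalPhysics.QuantumLattice.HubbardNNNHoppingTorusLimitCorrelator
import Literature.MathematicalPhysics.QuantumLattice.HubbardTTPrimeMeanEnergySupergradient
import HarnessLib

/-!
# The class of torus-limit ground states of the `t–t'` Hubbard model on `ℤ²` is stable under the
# point group `D₄`; every `t–t'` mean energy of a torus limit is `D₄`-invariant

Topic `Literature/MathematicalPhysics/QuantumLattice`; namespace
`Literature.MathematicalPhysics.QuantumLattice` (the file path). Companion of
`InfVolFermionStatePointGroupAction.lean` (`d4Act γ ω = ω ∘ γ`), `HubbardTTPrimePointGroupCovariance.lean`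
(`D₄` covariance of the local Hamiltonians; orbit sums of abstract ground states) and
`HubbardNNNHoppingTorusLimitCorrelator.lean` (`IsTorusLimitOf`, the `D₄`-reduced window certificates
read in torus-limit ground states). Written for the material-oracle stage S2 (cell `pub/hubbard-downfold`,
seat unc-1): the certified words of the tree are statements «for every torus limit `ω` of unit
`(rectN n L, S^z = 0)`-sector ground states of `hubbardTorusTT' L t t' U`», and the production
certificates are `D₄`-REDUCED (their conclusion is an orbit mean `|S|⁻¹ Σ_{g∈S} Re (ω∘g)(X)`); to
transport such words in the couplings one needs to know that `ω ∘ g` is again in the class and carries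
the same conjugate observables (double occupancy, diagonal-hopping energy). This file proves exactly that.

§1 TORUS DICTIONARY. `fockTranslate_eq_fockD4_conj` (`T_u = D_γ T_{γ⁻¹u} D_{γ⁻¹}` in the unitary group,
   from `Orb.d4Perm_mul_translate`), and `torusAvgExpectAt_d4` / `torusAvgExpect_d4`: the
   translation-averaged expectation of the rotated observable `Γ(d4Emb γ 0 Λ) A ∈ 𝔄_{γΛ}` in a torus
   vector `ψ` equals that of `A` in the rotated vector `D_{γ⁻¹} ψ` (`D_γ = fockD4 γ`):
   `Γ(ι_{γΛ})(Γ(d4Emb γ 0) A) = D_γ (Γ(ι_Λ) A) D_γᴴ` (`fermionEmbed_toTorusEmb_d4Emb`) and the translation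
   average is re-indexed by `u ↦ γ⁻¹ u`. Also: `D_γ ψ` is a unit vector / a sector ground state of
   `hubbardTorusTT' L t t' U` / has the same `t–t'` energy when `ψ` is / has
   (`star_fockD4_mulVec_dotProduct`, `IsGroundStateInSector.fockD4_mulVec_hubbardTorusTT'` — the tree's
   `IsGroundStateInSector.fockD4_mulVec` + `relabel_d4Perm_hubbardTorusTT'` —, `expect_hubbardTorusTT'_fockD4_mulVec`).
§2 THE ROTATED FAMILY at every side `L` (the Fock unitaries need `L ≠ 0`; at the empty torus `L = 0`,
   where every averaged expectation is the junk value `0`, the family is `ψ` itself):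
   `torusAvgExpect_d4_dite`, `star_dotProduct_d4_dite`, `IsGroundStateInSector.d4_dite`,
   `expect_hubbardTorusTT'_d4_dite`.
§3 THE CLASS IS `D₄`-STABLE. `IsTorusLimitOf.d4Act`: if `ω` is the torus limit of `ψ_L` along `Ls` then
   `ω ∘ γ` is the torus limit of the rotated family along `Ls`. Hence `forall_torusLimit_groundState_d4Act`:
   EVERY property certified for all torus limits of unit `(rectN n L, S^z = 0)`-sector ground states of
   `hubbardTorusTT' L t t' U` holds for `ω ∘ γ` whenever `ω` is such a limit — the words of the tree are
   `D₄`-stable although an individual torus limit need not be `D₄`-invariant.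
§4 INVARIANT READINGS. `d4Act_expect_docc` (any state: the point group fixes the origin),
   `IsTorusLimitOf.meanEnergy_hubbardTTPrime_d4Act`: `e_{Φ(t,t',U)}(ω ∘ γ) = e_{Φ(t,t',U)}(ω)` for every
   torus limit `ω` (along `Ls → ∞`) and all `t, t', U` (both are limits of `Re⟨ψ_L, H_L ψ_L⟩/L²`, and `D_γ`
   commutes with `H_L(t,t',U)`), in particular the diagonal-hopping energy `K₂ = e_{Φ(0,1,0)}`, the one-body
   energy `e_{Φ(t,t',0)}` and the on-site energy `e_{Φ(0,0,1)} = Re ω(n_{0↑}n_{0↓})`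
   (`IsTorusLimitOf.meanEnergy_onSite_d4Act_eq_re_expect_docc`); `IsTorusLimitOf.density_d4Act` is the
   tree's `d4Act_density`.

HONEST SCOPE: covariance / bookkeeping lemmas only — no number, no certificate, no claim about the Hubbard
ground state. Everything is PROVED; no definition, no named fact.

## Mathlib / tree search

REUSED: `fermionEmbed_toTorusEmb_d4Emb`, `injOn_proj_d4ShiftSet_iff`, `fockD4_val_mul_fockTranslate_val`,
`expect_relabel_fockRelabel_mulVec`,
`star_fockRelabel_mulVec_dotProduct`, `IsGroundStateInSector.fockD4_mulVec`, `relabel_d4Perm_hubbardTorusTT'`,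
`IsTorusLimitOf.tendsto_meanEnergy_hubbardTTPrime`, `IsTorusLimitOf.meanEnergy_onSite_eq_re_expect_docc`,
`d4Act_expect`, `d4Act_density`, `d4Vec_zero`, `d4Site_apply_inv`. `lean search 'd4Act'`: the transform
`ω ∘ γ` of record was so far only read in ABSTRACT (Bratteli–Robinson) ground states
(`HubbardTTPrimePointGroupCovariance` §4–§5); nothing on torus limits. PRECEDENT (Summits side, not importable
here): `Summit.Ventures.CertifiedManyBodySolver.HubbardAlg.GSWindowNodeD4Sound` proves the same re-indexing
(`torusAvgExpectAt_d4Map`, `isTorusLimitOf_d4Map`) for its file-local proof device `d4Map` and the pure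
Hubbard model inside a soundness proof; this file states the facts for the Literature transform of record
`InfVolFermionState.d4Act` and the `t–t'` model `hubbardTorusTT'`, where the transport theorems need them.

## References

* O. Bratteli, D. W. Robinson, *Operator Algebras and Quantum Statistical Mechanics 1*, 2nd ed., §4.3.1
  (`G`-invariant states, `ω ↦ ω ∘ τ_g`, averages over the group). [cite: BratteliRobinsonI1987, §4.3.1]
* O. Bratteli, D. W. Robinson, *OAQSM 2*, 2nd ed., §5.2.2 Thm. 5.2.5 (Bogoliubov automorphisms of
  one-particle bijections), §6.2.4 (periodic states, mean energy). [cite: BratteliRobinsonII1997, §5.2.2, Thm. 5.2.5]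
* X. Han, *Quantum many-body bootstrap*, arXiv:2006.06002 (2020), §3 (the symmetries `T_(1,0), T_(0,1), Π, R`
  of the square lattice; `F[U⁻¹ O U] = F[O]`). [cite: Han2020Bootstrap, §3]
* D. J. Scalapino, Phys. Rep. 250 (1995) 329, §2 (the point group `C₄ᵥ ≅ D₄` of the square lattice).
  [cite: Scalapino1995, §2]
* H. Xu et al., Science 384 (2024) eadh7691, eq. (1) (the `t–t'` Hubbard Hamiltonian). [cite: XuEtAl2024, eq. (1)]
* T. Koma, H. Tasaki, J. Stat. Phys. 76 (1994) 745, §1 (conjugate observables of linear couplings).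
  [cite: KomaTasaki1994, §1]
-/

noncomputable section

namespace Literature.MathematicalPhysics.QuantumLattice

open Matrix Finset HubbardWave0 Literature.Probability.LatticeModels ThermodynamicLimit
open Literature.MathematicalPhysics.QuantumManyBody.StateRelaxation
open _root_.Filter
open scoped _root_.Topology ComplexOrder BigOperators

/-! ### §1 Torus dictionary: rotated observables versus rotated vectors -/

section Torus

variable {L : ℕ} [NeZero L]

/-- **`D₄` unitaries preserve the norm**: `⟨D_γ ψ, D_γ ψ⟩ = ⟨ψ, ψ⟩`. [cite: BratteliRobinsonII1997, §5.2.2, Thm. 5.2.5] -/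
theorem star_fockD4_mulVec_dotProduct (γ : DihedralGroup 4) (ψ : Fock (Orb (FermionTorus 2 L))) :
    star ((fockD4 (L := L) γ).val *ᵥ ψ) ⬝ᵥ ((fockD4 (L := L) γ).val *ᵥ ψ) = star ψ ⬝ᵥ ψ := by
  rw [fockD4_apply]
  exact star_fockRelabel_mulVec_dotProduct _ ψ

/-- **Space-group bookkeeping in the unitary group**: `T_u = D_γ T_{γ⁻¹u} D_{γ⁻¹}` (`D_γ T_v = T_{γv} D_γ`).
[cite: Han2020Bootstrap, §3] -/
theorem fockTranslate_eq_fockD4_conj (γ : DihedralGroup 4) (u : TorusSite 2 L) :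
    fockTranslate u = fockD4 (L := L) γ * fockTranslate (d4Site γ⁻¹ u) * fockD4 (L := L) γ⁻¹ := by
  -- the computation is done in the permutation group and pushed through the homomorphism `fockRelabel`
  have hperm : Orb.translate u =
      Orb.d4Perm (L := L) γ * Orb.translate (d4Site γ⁻¹ u) * Orb.d4Perm (L := L) γ⁻¹ := by
    rw [Orb.d4Perm_mul_translate, d4Site_apply_inv, mul_assoc, ← map_mul, mul_inv_cancel, map_one, mul_one]
  rw [fockD4_apply, fockD4_apply, ← map_mul, ← map_mul, ← hperm]

/-- **Space-group bookkeeping on vectors**: `T_u ψ = D_γ (T_{γ⁻¹u} (D_{γ⁻¹} ψ))`. [cite: Han2020Bootstrap, §3] -/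
theorem fockTranslate_mulVec_eq_fockD4_conj (γ : DihedralGroup 4) (u : TorusSite 2 L)
    (ψ : Fock (Orb (FermionTorus 2 L))) :
    (fockTranslate u).val *ᵥ ψ =
      (fockRelabel (Orb.d4Perm (L := L) γ)).val *ᵥ
        ((fockTranslate (d4Site γ⁻¹ u)).val *ᵥ ((fockD4 (L := L) γ⁻¹).val *ᵥ ψ)) := by
  have hval : (fockD4 (L := L) γ * fockTranslate (d4Site γ⁻¹ u) * fockD4 (L := L) γ⁻¹).val =
      (fockRelabel (Orb.d4Perm (L := L) γ)).val * (fockTranslate (d4Site γ⁻¹ u)).val *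
        (fockD4 (L := L) γ⁻¹).val := rfl
  rw [mulVec_mulVec, mulVec_mulVec, ← hval, ← fockTranslate_eq_fockD4_conj]

/-- **Sector ground states of the `t–t'` torus Hamiltonian are `D₄`-covariant**: `D_γ ψ` is a ground
state of the sector `(N, S^z = M)` of `hubbardTorusTT' L t t' U` when `ψ` is (`U_γ H^{tt'} U_γ⁻¹ = H^{tt'}`).
[cite: XuEtAl2024, eq. (1)] -/
theorem IsGroundStateInSector.fockD4_mulVec_hubbardTorusTT' (γ : DihedralGroup 4) (t t' U : ℝ) {N : ℕ}
    {M : ℝ} {ψ : Fock (Orb (FermionTorus 2 L))}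
    (hψ : IsGroundStateInSector (hubbardTorusTT' L t t' U) N M ψ) :
    IsGroundStateInSector (hubbardTorusTT' L t t' U) N M ((fockD4 (L := L) γ).val *ᵥ ψ) :=
  hψ.fockD4_mulVec γ (relabel_d4Perm_hubbardTorusTT' γ t t' U)

/-- **The energy of a rotated vector**: `⟨D_γ ψ, H^{tt'}_L D_γ ψ⟩ = ⟨ψ, H^{tt'}_L ψ⟩`.
[cite: XuEtAl2024, eq. (1)] -/
theorem expect_hubbardTorusTT'_fockD4_mulVec (γ : DihedralGroup 4) (t t' U : ℝ)
    (ψ : Fock (Orb (FermionTorus 2 L))) :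
    star ((fockD4 (L := L) γ).val *ᵥ ψ) ⬝ᵥ (hubbardTorusTT' L t t' U *ᵥ ((fockD4 (L := L) γ).val *ᵥ ψ)) =
      star ψ ⬝ᵥ (hubbardTorusTT' L t t' U *ᵥ ψ) := by
  have h := expect_relabel_fockRelabel_mulVec (Orb.d4Perm (L := L) γ) (hubbardTorusTT' L t t' U) ψ
  rw [relabel_d4Perm_hubbardTorusTT'] at h
  rw [fockD4_apply]
  exact h

/-- **Rotated observable = rotated vector, for translation-averaged torus expectations.** For every
region `Λ ⊆ ℤ²`, `A ∈ 𝔄_Λ`, `γ ∈ D₄` and torus vector `ψ`: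
`torusAvgExpectAt L (γΛ) (Γ(d4Emb γ 0 Λ) A) ψ = torusAvgExpectAt L Λ A (D_{γ⁻¹} ψ)`.
(`Γ(ι_{γΛ,L})(Γ(d4Emb γ 0) A) = D_γ (Γ(ι_{Λ,L}) A) D_γᴴ`, `⟨T_u ψ, D_γ B D_γᴴ T_u ψ⟩ = ⟨T_{γ⁻¹u} D_{γ⁻¹} ψ, B T_{γ⁻¹u} D_{γ⁻¹} ψ⟩`
and `u ↦ γ⁻¹ u` is a bijection of the torus; both sides are the junk value `0` when `Λ` does not fit.)
[cite: BratteliRobinsonI1987, §4.3.1] [cite: Han2020Bootstrap, §3] -/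
theorem torusAvgExpectAt_d4 (γ : DihedralGroup 4) (Λ : Finset (Site 2)) (A : FermionOp Λ)
    (ψ : Fock (Orb (FermionTorus 2 L))) :
    torusAvgExpectAt L (d4ShiftSet γ 0 Λ) (fermionEmbed (PolySite.d4Emb γ 0 Λ) A) ψ =
      torusAvgExpectAt L Λ A ((fockD4 (L := L) γ⁻¹).val *ᵥ ψ) := by
  by_cases h : Set.InjOn (Torus.proj (d := 2) L) ↑Λ
  · have h' : Set.InjOn (Torus.proj (d := 2) L) ↑(d4ShiftSet γ 0 Λ) := (injOn_proj_d4ShiftSet_iff L γ 0 Λ).2 h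
    have hproj0 : Torus.proj L (0 : Site 2) = 0 := by
      funext i
      simp [Torus.proj]
    rw [torusAvgExpectAt_of_injOn L h', torusAvgExpectAt_of_injOn L h, fermionEmbed_toTorusEmb_d4Emb γ 0 h h' A,
      hproj0, Orb.translate_zero, Equiv.Perm.one_def, relabel_refl]
    refine congrArg (fun z : ℂ => ((Fintype.card (TorusSite 2 L) : ℂ))⁻¹ * z) ?_
    have hstep : ∀ u : TorusSite 2 L,
        expect (relabel (Orb.d4Perm γ) (fermionEmbed (PolySite.toTorusEmb L h) A)) ((fockTranslate u).val *ᵥ ψ) =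
          expect (fermionEmbed (PolySite.toTorusEmb L h) A)
            ((fockTranslate (d4Site γ⁻¹ u)).val *ᵥ ((fockD4 (L := L) γ⁻¹).val *ᵥ ψ)) := by
      intro u
      rw [fockTranslate_mulVec_eq_fockD4_conj γ u ψ]
      exact expect_relabel_fockRelabel_mulVec (Orb.d4Perm γ) _ _
    simp_rw [hstep]
    exact Fintype.sum_equiv (d4SitePerm (L := L) γ⁻¹) _ _ fun u => rfl
  · have h' : ¬ Set.InjOn (Torus.proj (d := 2) L) ↑(d4ShiftSet γ 0 Λ) :=
      fun h' => h ((injOn_proj_d4ShiftSet_iff L γ 0 Λ).1 h')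
    rw [torusAvgExpectAt_of_not_injOn L h', torusAvgExpectAt_of_not_injOn L h]

/-- `torusAvgExpectAt_d4` in the `torusAvgExpect` spelling (side `L ≠ 0`). [cite: BratteliRobinsonI1987, §4.3.1] -/
theorem torusAvgExpect_d4 (γ : DihedralGroup 4) (Λ : Finset (Site 2)) (A : FermionOp Λ)
    (ψ : Fock (Orb (FermionTorus 2 L))) :
    torusAvgExpect L (d4ShiftSet γ 0 Λ) (fermionEmbed (PolySite.d4Emb γ 0 Λ) A) ψ =
      torusAvgExpect L Λ A ((fockD4 (L := L) γ⁻¹).val *ᵥ ψ) := by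
  rw [torusAvgExpect_eq, torusAvgExpect_eq, torusAvgExpectAt_d4]

end Torus

/-! ### §2 The rotated family of torus vectors (all sides `L`, identity at the empty torus `L = 0`) -/

section Family

variable {L : ℕ}

/-- **Rotated observable = rotated vector, every side.** With the rotated vector defined as `D_γ ψ` for
`L ≠ 0` and `ψ` at the (irrelevant) empty torus `L = 0`, where both sides are the junk value `0`:
`torusAvgExpect L (γΛ) (Γ(d4Emb γ 0 Λ) A) ψ = torusAvgExpect L Λ A (D_{γ⁻¹} ψ)`. [cite: BratteliRobinsonI1987, §4.3.1] -/
theorem torusAvgExpect_d4_dite (γ : DihedralGroup 4) (Λ : Finset (Site 2)) (A : FermionOp Λ)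
    (ψ : Fock (Orb (FermionTorus 2 L))) :
    torusAvgExpect L (d4ShiftSet γ 0 Λ) (fermionEmbed (PolySite.d4Emb γ 0 Λ) A) ψ =
      torusAvgExpect L Λ A
        (if hL : L = 0 then ψ else haveI : NeZero L := ⟨hL⟩; (fockD4 (L := L) γ⁻¹).val *ᵥ ψ) := by
  by_cases hL : L = 0
  · subst hL
    rw [torusAvgExpect_zero, torusAvgExpect_zero]
  · haveI : NeZero L := ⟨hL⟩
    rw [dif_neg hL, torusAvgExpect_d4]

/-- The rotated vector is a unit vector when `ψ` is. [cite: BratteliRobinsonII1997, §5.2.2, Thm. 5.2.5] -/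
theorem star_dotProduct_d4_dite (γ : DihedralGroup 4) (ψ : Fock (Orb (FermionTorus 2 L))) :
    star (if hL : L = 0 then ψ else haveI : NeZero L := ⟨hL⟩; (fockD4 (L := L) γ).val *ᵥ ψ) ⬝ᵥ
        (if hL : L = 0 then ψ else haveI : NeZero L := ⟨hL⟩; (fockD4 (L := L) γ).val *ᵥ ψ) =
      star ψ ⬝ᵥ ψ := by
  by_cases hL : L = 0
  · rw [dif_pos hL]
  · haveI : NeZero L := ⟨hL⟩
    rw [dif_neg hL, star_fockD4_mulVec_dotProduct]

/-- The rotated vector is a sector ground state of `hubbardTorusTT' L t t' U` when `ψ` is.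
[cite: XuEtAl2024, eq. (1)] -/
theorem IsGroundStateInSector.d4_dite (γ : DihedralGroup 4) (t t' U : ℝ) {N : ℕ} {M : ℝ}
    {ψ : Fock (Orb (FermionTorus 2 L))} (hψ : IsGroundStateInSector (hubbardTorusTT' L t t' U) N M ψ) :
    IsGroundStateInSector (hubbardTorusTT' L t t' U) N M
      (if hL : L = 0 then ψ else haveI : NeZero L := ⟨hL⟩; (fockD4 (L := L) γ).val *ᵥ ψ) := by
  by_cases hL : L = 0
  · rw [dif_pos hL]
    exact hψ
  · haveI : NeZero L := ⟨hL⟩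
    rw [dif_neg hL]
    exact hψ.fockD4_mulVec_hubbardTorusTT' γ t t' U

/-- The rotated vector has the same `t–t'` energy as `ψ` at every coupling. [cite: XuEtAl2024, eq. (1)] -/
theorem expect_hubbardTorusTT'_d4_dite (γ : DihedralGroup 4) (t t' U : ℝ) (ψ : Fock (Orb (FermionTorus 2 L))) :
    star (if hL : L = 0 then ψ else haveI : NeZero L := ⟨hL⟩; (fockD4 (L := L) γ).val *ᵥ ψ) ⬝ᵥ
        (hubbardTorusTT' L t t' U *ᵥ
          (if hL : L = 0 then ψ else haveI : NeZero L := ⟨hL⟩; (fockD4 (L := L) γ).val *ᵥ ψ)) =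
      star ψ ⬝ᵥ (hubbardTorusTT' L t t' U *ᵥ ψ) := by
  by_cases hL : L = 0
  · rw [dif_pos hL]
  · haveI : NeZero L := ⟨hL⟩
    rw [dif_neg hL, expect_hubbardTorusTT'_fockD4_mulVec]

end Family

/-! ### §3 The class of torus limits (of sector ground states) is `D₄`-stable -/

namespace InfVolFermionState

/-- **Torus limits are `D₄`-covariant as a class.** If `ω` is the torus limit of the vectors `ψ_L`
along `Ls`, then the transformed state `ω ∘ γ` (`d4Act γ ω`) is the torus limit of the rotated vectors
`D_{γ⁻¹} ψ_L` (`ψ_0` at the empty torus) along the same `Ls` (term by term, `torusAvgExpect_d4_dite`). An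
individual torus limit need not be `D₄`-invariant; the CLASS of torus limits is.
[cite: BratteliRobinsonI1987, §4.3.1] [cite: Han2020Bootstrap, §3] -/
theorem IsTorusLimitOf.d4Act {ω : InfVolFermionState 2} {ψ : ∀ L, Fock (Orb (FermionTorus 2 L))}
    {Ls : ℕ → ℕ} (h : ω.IsTorusLimitOf ψ Ls) (γ : DihedralGroup 4) :
    (ω.d4Act γ).IsTorusLimitOf
      (fun L => if hL : L = 0 then ψ L else haveI : NeZero L := ⟨hL⟩; (fockD4 (L := L) γ⁻¹).val *ᵥ ψ L) Ls := by
  intro Λ A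
  rw [d4Act_expect]
  refine (h (d4ShiftSet γ 0 Λ) (fermionEmbed (PolySite.d4Emb γ 0 Λ) A)).congr fun j => ?_
  exact torusAvgExpect_d4_dite γ Λ A (ψ (Ls j))

/-- **Every torus-limit ground-state word is a word for `ω ∘ γ`.** Fix `t, t', U`, a density `n` and
`γ ∈ D₄`. If a property `P` holds for EVERY torus limit of unit `(rectN n (Ls j), S^z = 0)`-sector
ground states of `hubbardTorusTT' (Ls j) t t' U` along every `Ls → ∞`, then `P (ω ∘ γ)` holds for every
such torus limit `ω` — because `ω ∘ γ` is itself in the class (`IsTorusLimitOf.d4Act`,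
`IsGroundStateInSector.d4_dite`, `star_dotProduct_d4_dite`). The certified words of the tree (energy
windows, docc / one-body / `K₂` brackets, correlator bounds) have exactly this shape.
[cite: BratteliRobinsonI1987, §4.3.1] [cite: XuEtAl2024, eq. (1)] -/
theorem forall_torusLimit_groundState_d4Act (t t' U n : ℝ) {P : InfVolFermionState 2 → Prop}
    (hP : ∀ (ω : InfVolFermionState 2) (Ls : ℕ → ℕ) (ψ : ∀ L, Fock (Orb (FermionTorus 2 L))),
      Tendsto Ls atTop atTop →
      (∀ j, IsGroundStateInSector (hubbardTorusTT' (Ls j) t t' U) (rectN n (Ls j)) 0 (ψ (Ls j))) →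
      (∀ j, star (ψ (Ls j)) ⬝ᵥ ψ (Ls j) = 1) → ω.IsTorusLimitOf ψ Ls → P ω)
    (γ : DihedralGroup 4) {ω : InfVolFermionState 2} {Ls : ℕ → ℕ} {ψ : ∀ L, Fock (Orb (FermionTorus 2 L))}
    (hLs : Tendsto Ls atTop atTop)
    (hψ : ∀ j, IsGroundStateInSector (hubbardTorusTT' (Ls j) t t' U) (rectN n (Ls j)) 0 (ψ (Ls j)))
    (hψ1 : ∀ j, star (ψ (Ls j)) ⬝ᵥ ψ (Ls j) = 1) (hω : ω.IsTorusLimitOf ψ Ls) :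
    P (ω.d4Act γ) :=
  hP (ω.d4Act γ) Ls
    (fun L => if hL : L = 0 then ψ L else haveI : NeZero L := ⟨hL⟩; (fockD4 (L := L) γ⁻¹).val *ᵥ ψ L) hLs
    (fun j => (hψ j).d4_dite γ⁻¹ t t' U)
    (fun j => by rw [star_dotProduct_d4_dite]; exact hψ1 j) (hω.d4Act γ)

/-! ### §4 Invariant readings: double occupancy, density, and every `t–t'` mean energy -/

/-- **The point group fixes the origin: the double occupancy of `ω ∘ g` is that of `ω`**,
`(ω∘g)(n_{0↑}n_{0↓}) = ω(n_{0↑}n_{0↓})` (any state `ω`). [cite: Scalapino1995, §2] -/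
theorem d4Act_expect_docc (ω : InfVolFermionState 2) (g : DihedralGroup 4) :
    (ω.d4Act g).expect ({0} : Finset (Site 2))
        (nAt 0 (Finset.mem_singleton_self 0) 0 * nAt 0 (Finset.mem_singleton_self 0) 1) =
      ω.expect ({0} : Finset (Site 2))
        (nAt 0 (Finset.mem_singleton_self 0) 0 * nAt 0 (Finset.mem_singleton_self 0) 1) := by
  have hz' : (0 : Site 2) ∈ d4ShiftSet g 0 ({0} : Finset (Site 2)) := by
    have h := d4Vec_add_mem_d4ShiftSet g 0 (Finset.mem_singleton_self (0 : Site 2))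
    rwa [d4Vec_zero, add_zero] at h
  have hpt : PolySite.d4Emb g 0 ({0} : Finset (Site 2)) (PolySite.pt 0 (Finset.mem_singleton_self 0)) =
      PolySite.pt 0 hz' := Subtype.ext (by
    show toLex (d4Vec g (ofLex (toLex (0 : Site 2))) + 0) = toLex 0
    rw [ofLex_toLex, d4Vec_zero, add_zero])
  have hsub : ({0} : Finset (Site 2)) ⊆ d4ShiftSet g 0 ({0} : Finset (Site 2)) :=
    Finset.singleton_subset_iff.2 hz'
  rw [d4Act_expect, map_mul (fermionEmbed (PolySite.d4Emb g 0 ({0} : Finset (Site 2)))), fermionEmbed_numberOp,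
    fermionEmbed_numberOp, hpt, ← ω.compatible hsub, map_mul (fermionEmbed (PolySite.incl hsub)),
    fermionEmbed_numberOp, fermionEmbed_numberOp, PolySite.incl_pt]

/-- Real parts: `Re (ω∘g)(n_{0↑}n_{0↓}) = Re ω(n_{0↑}n_{0↓})` — the docc slot of every transported word.
[cite: Scalapino1995, §2] -/
theorem d4Act_re_expect_docc (ω : InfVolFermionState 2) (g : DihedralGroup 4) :
    ((ω.d4Act g).expect ({0} : Finset (Site 2))
        (nAt 0 (Finset.mem_singleton_self 0) 0 * nAt 0 (Finset.mem_singleton_self 0) 1)).re =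
      (ω.expect ({0} : Finset (Site 2))
        (nAt 0 (Finset.mem_singleton_self 0) 0 * nAt 0 (Finset.mem_singleton_self 0) 1)).re := by
  rw [d4Act_expect_docc]

/-- **Every `t–t'` mean energy of a torus limit is `D₄`-invariant**: if `ω` is a torus limit along
`Ls → ∞` then `e_{Φ(t,t',U)}(ω ∘ γ) = e_{Φ(t,t',U)}(ω)` for all `t, t', U` — both are the limit of
`Re⟨ψ_j, H_{Ls j}(t,t',U) ψ_j⟩/(Ls j)²` (`IsTorusLimitOf.tendsto_meanEnergy_hubbardTTPrime` for `ψ` and for the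
rotated vectors `D_{γ⁻¹}ψ`, whose energies agree because `D_{γ⁻¹}` commutes with `H_L(t,t',U)`). In particular
the diagonal-hopping energy `K₂ = e_{Φ(0,1,0)}`, the one-body energy `e_{Φ(t,t',0)}` and the on-site energy
`e_{Φ(0,0,1)}` (the conjugate observables of the couplings) take the same values in `ω ∘ γ` as in `ω`.
[cite: KomaTasaki1994, §1] [cite: XuEtAl2024, eq. (1)] -/
theorem IsTorusLimitOf.meanEnergy_hubbardTTPrime_d4Act (t t' U : ℝ) {ω : InfVolFermionState 2}
    {ψ : ∀ L, Fock (Orb (FermionTorus 2 L))} {Ls : ℕ → ℕ} (h : ω.IsTorusLimitOf ψ Ls)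
    (hLs : Tendsto Ls atTop atTop) (γ : DihedralGroup 4) :
    (ω.d4Act γ).meanEnergy (hubbardTTPrimeFermionInteraction t t' U) 1 =
      ω.meanEnergy (hubbardTTPrimeFermionInteraction t t' U) 1 := by
  have h1 := (h.d4Act γ).tendsto_meanEnergy_hubbardTTPrime t t' U hLs
  have h2 := h.tendsto_meanEnergy_hubbardTTPrime t t' U hLs
  refine tendsto_nhds_unique h1 (h2.congr fun j => ?_)
  rw [expect_hubbardTorusTT'_d4_dite]

/-- **The density of `ω ∘ γ` is that of `ω`** (restated next to its siblings; the tree's `d4Act_density`).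
[cite: Scalapino1995, §2] -/
theorem IsTorusLimitOf.density_d4Act {ω : InfVolFermionState 2} {ψ : ∀ L, Fock (Orb (FermionTorus 2 L))}
    {Ls : ℕ → ℕ} (_h : ω.IsTorusLimitOf ψ Ls) (γ : DihedralGroup 4) : (ω.d4Act γ).density = ω.density :=
  ω.d4Act_density γ

/-- **The docc slot of a torus limit, read through the on-site mean energy**: `e_{Φ(0,0,1)}(ω ∘ γ) =
Re ω(n_{0↑}n_{0↓})`. [cite: KomaTasaki1994, §1] -/
theorem IsTorusLimitOf.meanEnergy_onSite_d4Act_eq_re_expect_docc {ω : InfVolFermionState 2}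
    {ψ : ∀ L, Fock (Orb (FermionTorus 2 L))} {Ls : ℕ → ℕ} (h : ω.IsTorusLimitOf ψ Ls)
    (hLs : Tendsto Ls atTop atTop) (γ : DihedralGroup 4) :
    (ω.d4Act γ).meanEnergy (hubbardTTPrimeFermionInteraction 0 0 1) 1 =
      (ω.expect ({0} : Finset (Site 2))
        (nAt 0 (Finset.mem_singleton_self 0) 0 * nAt 0 (Finset.mem_singleton_self 0) 1)).re := by
  rw [h.meanEnergy_hubbardTTPrime_d4Act 0 0 1 hLs γ, h.meanEnergy_onSite_eq_re_expect_docc hLs]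

/-- **A window observable read in `ω ∘ g` through a larger window**: for `Λ ⊆ Λ'` and `A ∈ 𝔄_Λ`,
`(ω∘g)_{Λ'}(Γ(incl) A) = (ω∘g)_Λ(A)` (compatibility of the transformed state; bookkeeping for the transport
theorems, where the conjugate observables sit in `𝔄_{thicken {0} 1} ⊆ 𝔄_{Λ'}`). [cite: BratteliRobinsonI1987, §4.3.1] -/
theorem d4Act_expect_fermionEmbed_incl (ω : InfVolFermionState 2) (g : DihedralGroup 4) {Λ Λ' : Finset (Site 2)}
    (hΛ : Λ ⊆ Λ') (A : FermionOp Λ) :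
    (ω.d4Act g).expect Λ' (fermionEmbed (PolySite.incl hΛ) A) = (ω.d4Act g).expect Λ A :=
  (ω.d4Act g).compatible hΛ A

end InfVolFermionState

end Literature.MathematicalPhysics.QuantumLattice
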